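import Summits.QuantumAdvantage.QuantumAdvantage.Theorems.FlatDialLemmaU
import Summits.QuantumAdvantage.QuantumAdvantage.Theorems.FlatDialMMDual

/-!
# FlatDialCubeKey — module 8 of the lens-3 g11 «FlatDial» THEOREMS package (cell decomp-qadv): the cube key in BIT coordinates; Lemma U and MM duality for it

Modules 6 (`FlatDial.LemmaU.msubspace_unique`, stated over blocks `Fin r → Fin 8`) and 7 (`isDualOf_mmFun`, arbitrary permutation key) are
joined here in the tree's language of bit vectors `Fin n → Bool`:

* §1 `cod`/`dec` : `(Fin 3 → Bool) ≃ Fin 8` (bit `t ↦ 2^t`), `cod_xor` (xor ↦ `LemmaU.bx`);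
* §2 the key tables `q`, `qi` (inverse permutations of `Fin 8`) with ★ `g8_eq_bd : g8 x b = ⟨dec x, dec (q b)⟩` — the trace form `Tr(x·b³)` of
  module 6 IS a dot product against the (quadratic) permutation `q = P ∘ cube` (`P` = the trace Gram matrix of `𝔽₂[t]/(t³+t+1)`, a bit swap);
* §3 blocks `blk : (Fin (r*3) → Bool) → Fin r → Fin 8`, `unblk`, and the blockwise keys `cubeKey`, `cubeKeyInv` (mutually inverse);
* §4 ★ `cubeMM r := mmFun cubeKey 0` — the planted function `(x,z) ↦ Σ_j Tr(x_j z_j³)` on `r*3 + r*3` bits — with `isDualOf_cubeMM`,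
  `forrelation_cubeMM = 1` (module 7) and THE BRIDGE `bit_cubeMM : bit (cubeMM r (x ++ z)) = LemmaU.F (blk x, blk z)`;
* §5 ★★ `msubspace_unique_cubeMM` : LEMMA U IN BIT COORDINATES — a subset `V` of `𝔽₂^{6r}` closed under `⊕`, of size `8^r`, along which all
  second derivatives of `cubeMM r` vanish (the Dillon / `M`-subspace condition, in the shape of `FlatDial.validMCerts`) IS `{z = 0}`.

ZERO `def X : Prop`.  Provenance: HOME/decomp-qadv-lens-3/g11/ (record NODE-g11.md §12, LAND-g11.md step 8).
-/

set_option linter.dupNamespace false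

namespace Summit.QuantumAdvantage.QuantumAdvantage.Theorems.FlatDial

open Finset
open Literature.Computability.QuantumComplexity
open Literature.Computability.QuantumComplexity.BuzetChailloux (bxor zeroVec)
open Literature.Computability.QuantumComplexity.CubicForm (bit)
open Summit.QuantumAdvantage.QuantumAdvantage.Theorems.HintDial (IsDualOf bit_xor)
open Summit.QuantumAdvantage.QuantumAdvantage.Theorems.HintDial.Automaton (bd bit_bd)
open LemmaU (B bx g8 gz bitz P padd F D2F X0)

/-! ## 1. Three bits as an element of `Fin 8` -/

/-- `x ↦ Σ_t x_t 2^t`. -/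
def cod (x : Fin 3 → Bool) : B :=
  ⟨((bif x 0 then 1 else 0) + (bif x 1 then 2 else 0) + (bif x 2 then 4 else 0)) % 8, Nat.mod_lt _ (by norm_num)⟩

/-- bit `t` of `a`. -/
def dec (a : B) (t : Fin 3) : Bool := a.val.testBit t.val

/-- `cod ∘ dec = id` (finite check). -/
theorem cod_dec : ∀ a : B, cod (dec a) = a := by decide

/-- `dec ∘ cod = id`. -/
theorem dec_cod (x : Fin 3 → Bool) : dec (cod x) = x := by
  have key : ∀ a b c : Bool, ∀ t : Fin 3,
      Nat.testBit ((((bif a then 1 else 0) + (bif b then 2 else 0) + (bif c then 4 else 0)) % 8)) t.val = ![a, b, c] t := by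
    decide
  funext t
  have ht : x t = ![x 0, x 1, x 2] t := by fin_cases t <;> rfl
  rw [ht]
  exact key (x 0) (x 1) (x 2) t

/-- `dec` is injective. -/
theorem dec_injective : Function.Injective dec := Function.LeftInverse.injective cod_dec

/-- `dec` turns `bx` (xor of codes) into pointwise xor (finite check). -/
theorem dec_bx : ∀ a b : B, ∀ t : Fin 3, dec (bx a b) t = xor (dec a t) (dec b t) := by decide

/-- `cod` turns pointwise xor into `bx`. -/
theorem cod_xor (x y : Fin 3 → Bool) : cod (fun t => xor (x t) (y t)) = bx (cod x) (cod y) :=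
  dec_injective (by funext t; simp only [dec_bx, dec_cod])

/-- `cod 0 = 0`. -/
theorem cod_zero : cod (fun _ => false) = 0 := by decide

/-- `dec 0 = 0`. -/
theorem dec_zero (t : Fin 3) : dec 0 t = false := by
  simp only [dec, Fin.val_zero, Nat.zero_testBit]

/-! ## 2. The key: `Tr(x·b³) = ⟨x, q b⟩` -/

/-- the permutation `b ↦ P(b³)` of `Fin 8` (`P` = trace Gram matrix, the swap of bits 1 and 2). -/
def q (b : B) : B := (![0, 1, 5, 2, 3, 6, 7, 4] : Fin 8 → B) b

/-- its inverse `c ↦ (P c)⁵`. -/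
def qi (b : B) : B := (![0, 1, 3, 4, 7, 2, 5, 6] : Fin 8 → B) b

/-- `q ∘ qi = id` (finite check). -/
theorem q_qi : ∀ b : B, q (qi b) = b := by decide

/-- `qi ∘ q = id` (finite check). -/
theorem qi_q : ∀ b : B, qi (q b) = b := by decide

/-- ★ the trace form of module 6 is a dot product against the key: `g8 x b = ⟨dec x, dec (q b)⟩` (finite check, 64 cases). -/
theorem g8_eq_bd : ∀ x b : B, g8 x b = bd (dec x) (dec (q b)) := by decide +kernel

/-! ## 3. Blocks and the blockwise cube key -/

variable {r : ℕ}

/-- block `j` of a `3r`-bit vector, as an element of `Fin 8`. -/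
def blk (z : Fin (r * 3) → Bool) (j : Fin r) : B := cod fun t => z (finProdFinEquiv (j, t))

/-- the `3r`-bit vector with prescribed blocks. -/
def unblk (b : Fin r → B) (i : Fin (r * 3)) : Bool := dec (b (finProdFinEquiv.symm i).1) (finProdFinEquiv.symm i).2

/-- `unblk ∘ blk = id`. -/
theorem unblk_blk (z : Fin (r * 3) → Bool) : unblk (blk z) = z := by
  funext i
  simp only [unblk, blk, dec_cod]
  rw [Prod.mk.eta, Equiv.apply_symm_apply]

/-- `blk ∘ unblk = id`. -/
theorem blk_unblk (b : Fin r → B) : blk (unblk b) = b := by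
  funext j
  simp only [blk, unblk, Equiv.symm_apply_apply]
  exact cod_dec (b j)

/-- `blk` is injective. -/
theorem blk_injective : Function.Injective (blk (r := r)) := Function.LeftInverse.injective unblk_blk

/-- bits of a block. -/
theorem dec_blk (z : Fin (r * 3) → Bool) (j : Fin r) (t : Fin 3) : dec (blk z j) t = z (finProdFinEquiv (j, t)) := by
  simp only [blk, dec_cod]

/-- bits of `unblk`. -/
theorem unblk_apply (b : Fin r → B) (j : Fin r) (t : Fin 3) : unblk b (finProdFinEquiv (j, t)) = dec (b j) t := by
  simp only [unblk, Equiv.symm_apply_apply]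

/-- `blk` is blockwise additive. -/
theorem blk_bxor (a b : Fin (r * 3) → Bool) (j : Fin r) : blk (bxor a b) j = bx (blk a j) (blk b j) :=
  cod_xor _ _

/-- `blk 0 = 0`. -/
theorem blk_zeroVec (j : Fin r) : blk (zeroVec : Fin (r * 3) → Bool) j = 0 := cod_zero

/-- `unblk 0 = 0`. -/
theorem unblk_zero : unblk (fun _ : Fin r => (0 : B)) = zeroVec := by
  funext i; simp only [unblk, dec_zero]; rfl

/-- the blockwise cube key `z ↦ (P(z_j³))_j` in bit coordinates. -/
def cubeKey (z : Fin (r * 3) → Bool) : Fin (r * 3) → Bool := unblk fun j => q (blk z j)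

/-- its inverse. -/
def cubeKeyInv (z : Fin (r * 3) → Bool) : Fin (r * 3) → Bool := unblk fun j => qi (blk z j)

/-- `cubeKey ∘ cubeKeyInv = id`. -/
theorem cubeKey_cubeKeyInv (z : Fin (r * 3) → Bool) : cubeKey (cubeKeyInv z) = z := by
  simp only [cubeKey, cubeKeyInv, blk_unblk, q_qi]; exact unblk_blk z

/-- `cubeKeyInv ∘ cubeKey = id`. -/
theorem cubeKeyInv_cubeKey (z : Fin (r * 3) → Bool) : cubeKeyInv (cubeKey z) = z := by
  simp only [cubeKey, cubeKeyInv, blk_unblk, qi_q]; exact unblk_blk z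

/-! ## 4. The planted Maiorana–McFarland function in bit coordinates -/

variable (r) in
/-- ★ the cube-key MM function on `r*3 + r*3` bits: `(x, z) ↦ ⊕_j Tr(x_j z_j³)`. -/
def cubeMM : (Fin (r * 3 + r * 3) → Bool) → Bool := mmFun (cubeKey (r := r)) fun _ => false

variable (r) in
/-- its Maiorana–McFarland dual `(y₁, y₂) ↦ ⊕_j Tr((P y₁)_j⁵ · y_{2,j})` (in key form). -/
def cubeMMDual : (Fin (r * 3 + r * 3) → Bool) → Bool := mmDualFn (cubeKeyInv (r := r)) fun _ => false

/-- duality for the cube key (module 7). -/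
theorem isDualOf_cubeMM : IsDualOf (cubeMM r) (cubeMMDual r) :=
  isDualOf_mmFun cubeKey_cubeKeyInv cubeKeyInv_cubeKey

/-- `(cubeMM r, cubeMMDual r)` is an exact `+1` pair. -/
theorem forrelation_cubeMM : forrelation (cubeMM r) (cubeMMDual r) = 1 :=
  forrelation_mmFun_mmDualFn cubeKey_cubeKeyInv cubeKeyInv_cubeKey

/-- ★ THE BRIDGE to module 6: in bit coordinates the planted function is `LemmaU.F`. -/
theorem bit_cubeMM (x z : Fin (r * 3) → Bool) : bit (cubeMM r (Fin.append x z)) = F (blk x, blk z) := by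
  rw [cubeMM, mmFun_append, Bool.xor_false, bit_bd]
  simp only [LemmaU.F]
  rw [← (finProdFinEquiv (m := r) (n := 3)).sum_comp, Fintype.sum_prod_type]
  refine Finset.sum_congr rfl fun j _ => ?_
  have e : ∀ t : Fin 3, bit (x (finProdFinEquiv (j, t))) * bit (cubeKey z (finProdFinEquiv (j, t)))
      = bit (dec (blk x j) t) * bit (dec (q (blk z j)) t) := fun t => by
    rw [dec_blk, cubeKey, unblk_apply]
  simp_rw [e]
  rw [← bit_bd, ← g8_eq_bd]
  rfl

/-- encoding of a `6r`-bit point as a pair of block vectors. -/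
def enc (y : Fin (r * 3 + r * 3) → Bool) : P r :=
  (blk fun i => y (Fin.castAdd (r * 3) i), blk fun i => y (Fin.natAdd (r * 3) i))

/-- `enc` on appended halves. -/
theorem enc_append (x z : Fin (r * 3) → Bool) : enc (Fin.append x z) = (blk x, blk z) := by
  simp only [enc, Fin.append_left, Fin.append_right]

/-- `enc` is additive. -/
theorem enc_bxor (y u : Fin (r * 3 + r * 3) → Bool) : enc (bxor y u) = padd (enc y) (enc u) :=
  Prod.ext
    (funext fun j => blk_bxor (fun i => y (Fin.castAdd (r * 3) i)) (fun i => u (Fin.castAdd (r * 3) i)) j)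
    (funext fun j => blk_bxor (fun i => y (Fin.natAdd (r * 3) i)) (fun i => u (Fin.natAdd (r * 3) i)) j)

/-- `enc` is injective. -/
theorem enc_injective : Function.Injective (enc (r := r)) := by
  intro y y' h
  obtain ⟨⟨x, z⟩, rfl⟩ := (Fin.appendEquiv _ _).surjective y
  obtain ⟨⟨x', z'⟩, rfl⟩ := (Fin.appendEquiv _ _).surjective y'
  change enc (Fin.append x z) = enc (Fin.append x' z') at h
  change Fin.append x z = Fin.append x' z'
  rw [enc_append, enc_append, Prod.mk.injEq] at h
  rw [blk_injective h.1, blk_injective h.2]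

/-- `enc` is surjective. -/
theorem enc_surjective : Function.Surjective (enc (r := r)) := fun p =>
  ⟨Fin.append (unblk p.1) (unblk p.2), by rw [enc_append, blk_unblk, blk_unblk]⟩

/-- the bridge at an arbitrary point. -/
theorem bit_cubeMM_enc (y : Fin (r * 3 + r * 3) → Bool) : bit (cubeMM r y) = F (enc y) := by
  obtain ⟨⟨x, z⟩, rfl⟩ := (Fin.appendEquiv _ _).surjective y
  change bit (cubeMM r (Fin.append x z)) = F (enc (Fin.append x z))
  rw [enc_append]
  exact bit_cubeMM x z

/-- second derivatives: the Dillon condition of `FlatDial.validMCerts` is module 6's `D2F = 0`. -/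
theorem bit_d2_cubeMM (u v y : Fin (r * 3 + r * 3) → Bool) :
    bit (xor (xor (cubeMM r (bxor (bxor y u) v)) (cubeMM r (bxor y u))) (xor (cubeMM r (bxor y v)) (cubeMM r y)))
      = D2F (enc u) (enc v) (enc y) := by
  simp only [bit_xor, bit_cubeMM_enc, enc_bxor, LemmaU.D2F, LemmaU.padd_assoc]
  ring

/-! ## 5. Lemma U in bit coordinates -/

/-- ★★ LEMMA U IN BIT COORDINATES: the cube-key MM function on `6r` bits has the UNIQUE `M`-subspace `{z = 0}` — every `⊕`-closed `V` of
size `8^r` along which all second derivatives of `cubeMM r` vanish is `{y | y₂ = 0}`. -/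
theorem msubspace_unique_cubeMM (V : Finset (Fin (r * 3 + r * 3) → Bool))
    (hadd : ∀ u ∈ V, ∀ v ∈ V, bxor u v ∈ V)
    (hM : ∀ u ∈ V, ∀ v ∈ V, ∀ y,
      xor (xor (cubeMM r (bxor (bxor y u) v)) (cubeMM r (bxor y u))) (xor (cubeMM r (bxor y v)) (cubeMM r y)) = false)
    (hcard : V.card = 8 ^ r) :
    V = univ.filter fun y => ∀ i, y (Fin.natAdd (r * 3) i) = false := by
  classical
  have hadd' : ∀ u' ∈ V.image enc, ∀ v' ∈ V.image enc, padd u' v' ∈ V.image enc := by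
    intro u' hu' v' hv'
    obtain ⟨u, hu, rfl⟩ := mem_image.1 hu'
    obtain ⟨v, hv, rfl⟩ := mem_image.1 hv'
    exact mem_image.2 ⟨bxor u v, hadd u hu v hv, enc_bxor u v⟩
  have hM' : ∀ u' ∈ V.image enc, ∀ v' ∈ V.image enc, ∀ p, D2F u' v' p = 0 := by
    intro u' hu' v' hv' p
    obtain ⟨u, hu, rfl⟩ := mem_image.1 hu'
    obtain ⟨v, hv, rfl⟩ := mem_image.1 hv'
    obtain ⟨y, rfl⟩ := enc_surjective p
    rw [← bit_d2_cubeMM, hM u hu v hv y]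
    rfl
  have hcard' : (V.image enc).card = 8 ^ r := by rw [card_image_of_injective _ enc_injective, hcard]
  have key : V.image enc = X0 := LemmaU.msubspace_unique hadd' hM' hcard'
  have memX0 : ∀ y : Fin (r * 3 + r * 3) → Bool, enc y ∈ (X0 : Finset (P r)) ↔ ∀ i, y (Fin.natAdd (r * 3) i) = false := by
    intro y
    simp only [LemmaU.X0, mem_filter, mem_univ, true_and]
    constructor
    · intro h i
      have h2 : (fun i => y (Fin.natAdd (r * 3) i)) = zeroVec := by
        rw [← unblk_blk (fun i => y (Fin.natAdd (r * 3) i)), show blk (fun i => y (Fin.natAdd (r * 3) i)) = fun _ => 0 from h,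
          unblk_zero]
      exact congrFun h2 i
    · intro h
      show blk (fun i => y (Fin.natAdd (r * 3) i)) = fun _ => 0
      rw [show (fun i => y (Fin.natAdd (r * 3) i)) = zeroVec from funext h]
      funext j; exact blk_zeroVec j
  ext y
  simp only [mem_filter, mem_univ, true_and]
  constructor
  · intro hy
    exact (memX0 y).1 (key ▸ mem_image_of_mem enc hy)
  · intro hy
    have h : enc y ∈ V.image enc := by rw [key]; exact (memX0 y).2 hy
    obtain ⟨y', hy', he⟩ := mem_image.1 h
    exact enc_injective he ▸ hy'

end Summit.QuantumAdvantage.QuantumAdvantage.Theorems.FlatDial
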